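import Mathlib
import Summits.KontsevichZagierPeriods.KontsevichZagierPeriods.Theorems.SoloInformedDivisionTorsion
import HarnessLib
import HarnessLib.Audit

/-!
# Division by translation VIII: the trisection packet is a division chain (solo-informed, s43)

A NON-VACUITY WITNESS for `SoloInformedDivChain` at order `q = 3` and the resulting closed forms.
The real 3-torsion packet of the Legendre–Jacobi curve is RATIONALLY PARAMETRISED by
`s = sn(K/3 | m) ∈ (½, 1)`: the trisection equation `sn(2K/3) = cd(K/3)`, i.e.
`m s⁴ − 2m s³ + 2s − 1 = 0`, solves as `m = (2s−1)/(s³(2−s))`, and then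
`sn(2K/3) = √(s(2−s))`, `cn(2K/3) = 1−s`, `dn(2K/3) = (1−s)/s`, `cn dn(K/3) = (1−s²)/√(s(2−s))`.
So `(0, s, √(s(2−s)), 1)` is a division chain of order `3` for `m(s)` (`soloInformedDivChainThree`:
the two addition-map steps and the turn conditions are identities/inequalities of rational functions
of `s` and one square root), and THEOREM XXIX(i) KERNEL (part VII) specialises to

  **`⟦Π((2s−1)/(s(2−s)) | m(s))⟧ = ⟦[pt, (2−s)/(3(1−s))]⟧ · ⟦K(m(s))⟧`**   (`p = 1`, `n = m s²`),

for every real algebraic `½ < s < 1` and all representations (`soloInformed_trisection_thirdKind`,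
`…_value`), and at the second division point (`p = 2`, `n = m s₂² = (2s−1)/s²`)

  **`⟦Π((2s−1)/s² | m(s))⟧ = ⟦[pt, (s²−s+1)/(3(1−s)²)]⟧ · ⟦K(m(s))⟧`**   (`soloInformed_trisection_thirdKind₂`);

fibre `s = ⅔` (`m = 27/32`): `3·Π(⅜ | 27/32) = 4·K`, `3·Π(¾ | 27/32) = 7·K` (`…_fibre`, `…_fibre₂`).  This is
COR XXIX.7's packet (order 3, there by Abel's theorem XXX on a 2-form), here by ONE-DIMENSIONAL moves.

References: C. G. J. Jacobi, *Fundamenta nova* (1829), §§20, 55; A. Cayley, *Elliptic Functions*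
(1895), ch. IX (trisection); M. Kontsevich, D. Zagier, *Periods* (2001), §1.2; this work.
-/

noncomputable section

open MeasureTheory Set Filter
open scoped Classical

open Literature.NumberTheory.Transcendental Literature.NumberTheory.Transcendental.KZ
open Literature.ModelTheory.ExponentialFields

namespace Summit.KontsevichZagierPeriods.KontsevichZagierPeriods.Theorems

/-- Modulus of the trisection packet: `m(s) = (2s−1)/(s³(2−s))`, `s = sn(K/3 | m)`. [Jacobi 1829] -/
def soloInformedM3 (s : ℝ) : ℝ := (2 * s - 1) / (s ^ 3 * (2 - s))

/-- Abscissae of the trisection chain: `0, s, √(s(2−s)), 1, 1, …`. [this work] -/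
def soloInformedS3 (s : ℝ) : ℕ → ℝ := fun j =>
  if j = 0 then 0 else if j = 1 then s else if j = 2 then √(s * (2 - s)) else 1

/-- `s₀ = 0`. -/
theorem soloInformed_s3_zero {s : ℝ} : soloInformedS3 s 0 = 0 := by simp [soloInformedS3]
/-- `s₁ = s`. -/
theorem soloInformed_s3_one {s : ℝ} : soloInformedS3 s 1 = s := by simp [soloInformedS3]
/-- `s₂ = √(s(2−s))`. -/
theorem soloInformed_s3_two {s : ℝ} : soloInformedS3 s 2 = √(s * (2 - s)) := by
  simp [soloInformedS3]
/-- `s₃ = 1`. -/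
theorem soloInformed_s3_three {s : ℝ} : soloInformedS3 s 3 = 1 := by simp [soloInformedS3]

/-- `0 < m(s) < 1` for `½ < s < 1` (`s³(2−s) − (2s−1) = (1−s)³(1+s)`). [this work] -/
theorem soloInformed_m3_mem {s : ℝ} (hs : s ∈ Ioo (1/2:ℝ) 1) : soloInformedM3 s ∈ Ioo (0:ℝ) 1 := by
  have h0 : 0 < s := by linarith [hs.1]
  have h2 : 0 < 2 - s := by linarith [hs.2]
  have hden : 0 < s ^ 3 * (2 - s) := by positivity
  refine ⟨div_pos (by linarith [hs.1]) hden, (div_lt_one hden).2 ?_⟩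
  have h1 : 0 < 1 - s := by linarith [hs.2]
  nlinarith [mul_pos (mul_pos h1 h1) (mul_pos h1 (by linarith [hs.1] : (0:ℝ) < 1 + s))]

/-- `m(s)` is algebraic for algebraic `s`. [folklore] -/
theorem soloInformed_m3_isAlgebraic {s : ℝ} (hsa : IsAlgebraic ℚ s) :
    IsAlgebraic ℚ (soloInformedM3 s) := by
  have h2 : IsAlgebraic ℚ (2:ℝ) := by simpa using isAlgebraic_nat (R := ℚ) (A := ℝ) 2
  rw [soloInformedM3, div_eq_mul_inv]
  exact ((h2.mul hsa).sub isAlgebraic_one).mul ((hsa.pow 3).mul (h2.sub hsa)).inv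

/-- The rational identities of the trisection packet. [this work] -/
theorem soloInformed_s3_facts {s : ℝ} (hs : s ∈ Ioo (1/2:ℝ) 1) :
    1 - soloInformedM3 s * s ^ 2 = (1 - s ^ 2) / (s * (2 - s)) ∧
    1 - soloInformedM3 s * s ^ 2 * s ^ 2 = 2 * (1 - s ^ 2) / (2 - s) ∧
    1 - soloInformedM3 s * (s * (2 - s)) = (1 - s) ^ 2 / s ^ 2 ∧
    1 - soloInformedM3 s * (s * (2 - s)) * s ^ 2 = 2 * (1 - s) := by
  have h0 : s ≠ 0 := (by linarith [hs.1] : (0:ℝ) < s).ne'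
  have h2 : 2 - s ≠ 0 := (by linarith [hs.2] : (0:ℝ) < 2 - s).ne'
  unfold soloInformedM3
  refine ⟨?_, ?_, ?_, ?_⟩
  · field_simp; ring
  · field_simp; ring
  · field_simp; ring
  · field_simp; ring

/-- The square roots of the trisection packet in closed form. [this work] -/
theorem soloInformed_s3_sqrt {s : ℝ} (hs : s ∈ Ioo (1/2:ℝ) 1) :
    0 < √(s * (2 - s)) ∧ (√(s * (2 - s))) ^ 2 = s * (2 - s) ∧
    √(1 - s ^ 2) * √(1 - soloInformedM3 s * s ^ 2) = (1 - s ^ 2) / √(s * (2 - s)) ∧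
    √((1 - s ^ 2) * (1 - soloInformedM3 s * s ^ 2)) = (1 - s ^ 2) / √(s * (2 - s)) ∧
    √(1 - (√(s * (2 - s))) ^ 2) = 1 - s ∧
    √(1 - soloInformedM3 s * (√(s * (2 - s))) ^ 2) = (1 - s) / s := by
  obtain ⟨f1, -, f3, -⟩ := soloInformed_s3_facts hs
  have h0 : 0 < s := by linarith [hs.1]
  have hpos : 0 < s * (2 - s) := mul_pos h0 (by linarith [hs.2])
  have hσ : 0 < √(s * (2 - s)) := Real.sqrt_pos.2 hpos
  have hsq : (√(s * (2 - s))) ^ 2 = s * (2 - s) := Real.sq_sqrt hpos.le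
  have h1s : 0 ≤ 1 - s ^ 2 := by nlinarith [hs.1, hs.2]
  have hprod : (1 - s ^ 2) * (1 - soloInformedM3 s * s ^ 2) =
      ((1 - s ^ 2) / √(s * (2 - s))) ^ 2 := by
    rw [f1, div_pow, hsq]; ring
  have hsqrt : √((1 - s ^ 2) * (1 - soloInformedM3 s * s ^ 2)) = (1 - s ^ 2) / √(s * (2 - s)) := by
    rw [hprod, Real.sqrt_sq (div_nonneg h1s hσ.le)]
  refine ⟨hσ, hsq, by rw [← Real.sqrt_mul h1s, hsqrt], hsqrt, ?_, ?_⟩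
  · rw [hsq, show 1 - s * (2 - s) = (1 - s) ^ 2 by ring,
      Real.sqrt_sq (by linarith [hs.2] : (0:ℝ) ≤ 1 - s)]
  · rw [hsq, f3, ← div_pow, Real.sqrt_sq (div_nonneg (by linarith [hs.2]) h0.le)]

/-- First step of the chain: `T_s(s) = √(s(2−s))` (`sn(2K/3) = sn(K/3 + K/3)`). [this work] -/
theorem soloInformed_s3_step1 {s : ℝ} (hs : s ∈ Ioo (1/2:ℝ) 1) :
    soloInformedAddm (soloInformedM3 s) s s = √(s * (2 - s)) := by
  obtain ⟨-, f2, -, -⟩ := soloInformed_s3_facts hs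
  obtain ⟨hσ, hsq, hcd, -, -, -⟩ := soloInformed_s3_sqrt hs
  have h1s : (0:ℝ) < 1 - s ^ 2 := by nlinarith [hs.1, hs.2]
  have h2 : (0:ℝ) < 2 - s := by linarith [hs.2]
  have key : √(s * (2 - s)) / (2 - s) = s / √(s * (2 - s)) := by
    rw [div_eq_div_iff h2.ne' hσ.ne', ← pow_two, hsq]
  unfold soloInformedAddm
  rw [hcd, f2, div_eq_iff (div_pos (mul_pos two_pos h1s) h2).ne']
  calc s * ((1 - s ^ 2) / √(s * (2 - s))) + s * ((1 - s ^ 2) / √(s * (2 - s)))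
        = 2 * (1 - s ^ 2) * (s / √(s * (2 - s))) := by ring
    _ = 2 * (1 - s ^ 2) * (√(s * (2 - s)) / (2 - s)) := by rw [key]
    _ = √(s * (2 - s)) * (2 * (1 - s ^ 2) / (2 - s)) := by ring

/-- Second step of the chain: `T_{√(s(2−s))}(s) = 1` (`sn(2K/3 + K/3) = 1`). [this work] -/
theorem soloInformed_s3_step2 {s : ℝ} (hs : s ∈ Ioo (1/2:ℝ) 1) :
    soloInformedAddm (soloInformedM3 s) (√(s * (2 - s))) s = 1 := by
  obtain ⟨-, -, -, f4⟩ := soloInformed_s3_facts hs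
  obtain ⟨hσ, hsq, hcd, -, hc2, hd2⟩ := soloInformed_s3_sqrt hs
  have h0 : s ≠ 0 := (by linarith [hs.1] : (0:ℝ) < s).ne'
  have h1 : 1 - s ≠ 0 := (by linarith [hs.2] : (0:ℝ) < 1 - s).ne'
  have hσ0 : √(s * (2 - s)) ≠ 0 := hσ.ne'
  unfold soloInformedAddm
  rw [hc2, hd2, hcd, hsq, f4, div_eq_iff (mul_ne_zero two_ne_zero h1)]
  field_simp
  ring

/-- **The trisection chain** `(0, s, √(s(2−s)), 1)` is a division chain of order `3` for the modulus
`m(s) = (2s−1)/(s³(2−s))`, for every real algebraic `½ < s < 1`: a non-vacuity witness for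
`SoloInformedDivChain`. [this work] -/
def soloInformedDivChainThree (s : ℝ) (hs : s ∈ Ioo (1/2:ℝ) 1) (hsa : IsAlgebraic ℚ s) :
    SoloInformedDivChain (soloInformedM3 s) 3 where
  s := soloInformedS3 s
  s_zero := soloInformed_s3_zero
  one_pos := by rw [soloInformed_s3_one]; linarith [hs.1]
  one_le := by rw [soloInformed_s3_one]; exact hs.2.le
  one_isAlgebraic := by rw [soloInformed_s3_one]; exact hsa
  step := by
    intro j hj
    interval_cases j
    · show soloInformedS3 s 1 = _
      rw [soloInformed_s3_one, soloInformed_s3_zero, soloInformed_addm_origin]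
    · show soloInformedS3 s 2 = _
      rw [soloInformed_s3_two, soloInformed_s3_one, soloInformed_s3_step1 hs]
    · show soloInformedS3 s 3 = _
      rw [soloInformed_s3_three, soloInformed_s3_two, soloInformed_s3_one, soloInformed_s3_step2 hs]
  turn := by
    obtain ⟨f1, -, f3, -⟩ := soloInformed_s3_facts hs
    obtain ⟨hσ, hsq, -, -, -, -⟩ := soloInformed_s3_sqrt hs
    have h0 : 0 < s := by linarith [hs.1]
    have h2 : 0 < 2 - s := by linarith [hs.2]
    intro j hj
    interval_cases j
    · rw [soloInformed_s3_one, soloInformed_s3_zero]; nlinarith [hs.1, hs.2]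
    · rw [soloInformed_s3_one, f1]
      have h1s : (0:ℝ) ≤ 1 - s ^ 2 := by nlinarith [hs.1, hs.2]
      have e : s ^ 2 * ((1 - s ^ 2) / (s * (2 - s))) = (1 - s ^ 2) * (s / (2 - s)) := by
        field_simp
      rw [e]
      exact mul_le_of_le_one_right h1s (by rw [div_le_one h2]; linarith [hs.2])
    · rw [soloInformed_s3_one, soloInformed_s3_two, hsq, f3]
      apply le_of_eq
      field_simp
      ring
  top := soloInformed_s3_three

/-- The underlying sequence of the trisection chain is `soloInformedS3 s`. -/
theorem soloInformed_divChainThree_s {s : ℝ} (hs : s ∈ Ioo (1/2:ℝ) 1) (hsa : IsAlgebraic ℚ s) :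
    (soloInformedDivChainThree s hs hsa).s = soloInformedS3 s := rfl

/-- `ζ₃ = m s·(s·s₂ + s₂)` along the trisection chain (`ζ₁ = 0`). [this work] -/
theorem soloInformed_divChainThree_zeta {s : ℝ} (hs : s ∈ Ioo (1/2:ℝ) 1) (hsa : IsAlgebraic ℚ s) :
    (soloInformedDivChainThree s hs hsa).zeta 3 =
      soloInformedM3 s * s * (s * √(s * (2 - s)) + √(s * (2 - s))) := by
  rw [SoloInformedDivChain.zeta, Finset.sum_range_succ, Finset.sum_range_succ,
    Finset.sum_range_succ, Finset.sum_range_zero, soloInformed_divChainThree_s]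
  simp only [soloInformed_s3_zero, soloInformed_s3_one, soloInformed_s3_two, soloInformed_s3_three,
    Nat.reduceAdd]
  ring

/-- **THEOREM XXIX(i) at order 3, closed form.** For every real algebraic `½ < s < 1`, with
`m = (2s−1)/(s³(2−s))` and `n = m s² = (2s−1)/(s(2−s))` (`= m sn²(K/3|m)`), and all representations:
`⟦Π(n | m)⟧ = ⟦[pt, (2−s)/(3(1−s))]⟧·⟦K(m)⟧` in `P`. [this work] -/
theorem soloInformed_trisection_thirdKind (s : ℝ) (hs : s ∈ Ioo (1/2:ℝ) 1) (hsa : IsAlgebraic ℚ s)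
    (PN K : IntegralRep 1) (hPNd : PN.domain = {x | x 0 ∈ Ioo (0:ℝ) 1})
    (hPNi : EqOn PN.integrand (fun x => (1 - (2 * s - 1) / (s * (2 - s)) * x 0 ^ 2)⁻¹ *
      ((√(1 - x 0 ^ 2))⁻¹ * (√(1 - (2 * s - 1) / (s ^ 3 * (2 - s)) * x 0 ^ 2))⁻¹)) PN.domain)
    (hKd : K.domain = {x | x 0 ∈ Ioo (0:ℝ) 1})
    (hKi : EqOn K.integrand (fun x => (√(1 - x 0 ^ 2))⁻¹ *
      (√(1 - (2 * s - 1) / (s ^ 3 * (2 - s)) * x 0 ^ 2))⁻¹) K.domain) :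
    IsAlgebraic ℚ ((2 - s) / (3 * (1 - s))) ∧ ∀ hl : IsAlgebraic ℚ ((2 - s) / (3 * (1 - s))),
      toFormalPeriod (of PN) =
        toFormalPeriod (of (IntegralRep.unit.constMul _ hl)) * toFormalPeriod (of K) := by
  have hm := soloInformed_m3_mem hs
  have hma := soloInformed_m3_isAlgebraic hsa
  obtain ⟨hσ, hsq, -, hsqrt, -, -⟩ := soloInformed_s3_sqrt hs
  have h0 : s ≠ 0 := (by linarith [hs.1] : (0:ℝ) < s).ne'
  have h1 : 1 - s ≠ 0 := (by linarith [hs.2] : (0:ℝ) < 1 - s).ne'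
  have h1' : 1 + s ≠ 0 := (by linarith [hs.1] : (0:ℝ) < 1 + s).ne'
  have h1s : 1 - s ^ 2 ≠ 0 := (by nlinarith [hs.1, hs.2] : (0:ℝ) < 1 - s ^ 2).ne'
  have h2 : 2 - s ≠ 0 := (by linarith [hs.2] : (0:ℝ) < 2 - s).ne'
  have hσ0 : √(s * (2 - s)) ≠ 0 := hσ.ne'
  have h2a : IsAlgebraic ℚ (2:ℝ) := by simpa using isAlgebraic_nat (R := ℚ) (A := ℝ) 2
  have h3a : IsAlgebraic ℚ (3:ℝ) := by simpa using isAlgebraic_nat (R := ℚ) (A := ℝ) 3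
  have hl : IsAlgebraic ℚ ((2 - s) / (3 * (1 - s))) := by
    rw [div_eq_mul_inv]; exact (h2a.sub hsa).mul (h3a.mul (isAlgebraic_one.sub hsa)).inv
  have hn : soloInformedM3 s * s ^ 2 = (2 * s - 1) / (s * (2 - s)) := by
    unfold soloInformedM3; field_simp
  have hS1 : (soloInformedDivChainThree s hs hsa).s 1 = s := soloInformed_s3_one
  have hPNi' : EqOn PN.integrand (fun x => (1 - soloInformedM3 s *
      (soloInformedDivChainThree s hs hsa).s 1 ^ 2 * x 0 ^ 2)⁻¹ *
      ((√(1 - x 0 ^ 2))⁻¹ * (√(1 - (2 * s - 1) / (s ^ 3 * (2 - s)) * x 0 ^ 2))⁻¹)) PN.domain := by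
    intro x hx
    rw [hPNi hx, hS1, hn]
  refine ⟨hl, fun hl' => ?_⟩
  obtain ⟨hl0, h⟩ := soloInformed_divChain_thirdKind_pointClass (soloInformedDivChainThree s hs hsa)
    hm hma (p := 1) one_pos (by norm_num) PN K hPNd hPNi' hKd hKi
  rw [h hl0, soloInformed_pointRep_congr hl0 hl' ?_]
  -- the closed form of `λ`
  rw [hS1, soloInformed_divChainThree_zeta hs hsa, SoloInformedDivChain.zeta_one, hsqrt]
  push_cast
  have e1 : ((3:ℝ) * ((1 - s ^ 2) / √(s * (2 - s)) / s))⁻¹ *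
      (1 * (soloInformedM3 s * s * (s * √(s * (2 - s)) + √(s * (2 - s)))) - 3 * 0) =
      soloInformedM3 s * s ^ 2 * (√(s * (2 - s))) ^ 2 * (1 + s) / (3 * (1 - s ^ 2)) := by
    field_simp
    ring
  rw [e1, hsq]
  unfold soloInformedM3
  field_simp
  ring

/-- **THEOREM XXIX(i) at order 3, numerically:** `Π((2s−1)/(s(2−s)) | (2s−1)/(s³(2−s))) =
(2−s)/(3(1−s)) · K`. [this work] -/
theorem soloInformed_trisection_thirdKind_value (s : ℝ) (hs : s ∈ Ioo (1/2:ℝ) 1)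
    (hsa : IsAlgebraic ℚ s)
    (PN K : IntegralRep 1) (hPNd : PN.domain = {x | x 0 ∈ Ioo (0:ℝ) 1})
    (hPNi : EqOn PN.integrand (fun x => (1 - (2 * s - 1) / (s * (2 - s)) * x 0 ^ 2)⁻¹ *
      ((√(1 - x 0 ^ 2))⁻¹ * (√(1 - (2 * s - 1) / (s ^ 3 * (2 - s)) * x 0 ^ 2))⁻¹)) PN.domain)
    (hKd : K.domain = {x | x 0 ∈ Ioo (0:ℝ) 1})
    (hKi : EqOn K.integrand (fun x => (√(1 - x 0 ^ 2))⁻¹ *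
      (√(1 - (2 * s - 1) / (s ^ 3 * (2 - s)) * x 0 ^ 2))⁻¹) K.domain) :
    PN.value = (2 - s) / (3 * (1 - s)) * K.value := by
  obtain ⟨hl, h⟩ := soloInformed_trisection_thirdKind s hs hsa PN K hPNd hPNi hKd hKi
  have e := congrArg evalP (h hl)
  simpa only [map_mul, evalP_toFormalPeriod_of, IntegralRep.value_constMul,
    IntegralRep.value_unit, mul_one] using e

/-- The fibre `s = ⅔`: `m = 27/32`, `n = ⅜`, **`3·Π(⅜ | 27/32) = 4·K(27/32)`**, for all
representations. [this work] -/
theorem soloInformed_trisection_fibre (PN K : IntegralRep 1)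
    (hPNd : PN.domain = {x | x 0 ∈ Ioo (0:ℝ) 1})
    (hPNi : EqOn PN.integrand (fun x => (1 - 3 / 8 * x 0 ^ 2)⁻¹ *
      ((√(1 - x 0 ^ 2))⁻¹ * (√(1 - 27 / 32 * x 0 ^ 2))⁻¹)) PN.domain)
    (hKd : K.domain = {x | x 0 ∈ Ioo (0:ℝ) 1})
    (hKi : EqOn K.integrand (fun x => (√(1 - x 0 ^ 2))⁻¹ * (√(1 - 27 / 32 * x 0 ^ 2))⁻¹)
      K.domain) :
    3 * PN.value = 4 * K.value := by
  have hs : (2/3 : ℝ) ∈ Ioo (1/2:ℝ) 1 := by norm_num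
  have hsa : IsAlgebraic ℚ (2/3 : ℝ) := by
    simpa using isAlgebraic_algebraMap (R := ℚ) (A := ℝ) (2/3 : ℚ)
  have hn : (2 * (2/3:ℝ) - 1) / ((2/3) * (2 - 2/3)) = 3 / 8 := by norm_num
  have hm : (2 * (2/3:ℝ) - 1) / ((2/3) ^ 3 * (2 - 2/3)) = 27 / 32 := by norm_num
  have hv := soloInformed_trisection_thirdKind_value (2/3) hs hsa PN K hPNd
    (by rw [hn, hm]; exact hPNi) hKd (by rw [hm]; exact hKi)
  rw [hv]
  norm_num
  ring

/-- `ζ₂ = m s·(s·s₂)` along the trisection chain. [this work] -/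
theorem soloInformed_divChainThree_zeta₂ {s : ℝ} (hs : s ∈ Ioo (1/2:ℝ) 1) (hsa : IsAlgebraic ℚ s) :
    (soloInformedDivChainThree s hs hsa).zeta 2 =
      soloInformedM3 s * s * (s * √(s * (2 - s))) := by
  rw [SoloInformedDivChain.zeta, Finset.sum_range_succ, Finset.sum_range_succ, Finset.sum_range_zero,
    soloInformed_divChainThree_s]
  simp only [soloInformed_s3_zero, soloInformed_s3_one, soloInformed_s3_two, Nat.reduceAdd]
  ring

/-- **THEOREM XXIX(i) at order 3, second division point.** For every real algebraic `½ < s < 1`,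
`m = (2s−1)/(s³(2−s))`, `n = m·sn²(2K/3|m) = (2s−1)/s²`, and all representations:
`⟦Π(n | m)⟧ = ⟦[pt, (s²−s+1)/(3(1−s)²)]⟧·⟦K(m)⟧` in `P`. [this work] -/
theorem soloInformed_trisection_thirdKind₂ (s : ℝ) (hs : s ∈ Ioo (1/2:ℝ) 1) (hsa : IsAlgebraic ℚ s)
    (PN K : IntegralRep 1) (hPNd : PN.domain = {x | x 0 ∈ Ioo (0:ℝ) 1})
    (hPNi : EqOn PN.integrand (fun x => (1 - (2 * s - 1) / s ^ 2 * x 0 ^ 2)⁻¹ *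
      ((√(1 - x 0 ^ 2))⁻¹ * (√(1 - (2 * s - 1) / (s ^ 3 * (2 - s)) * x 0 ^ 2))⁻¹)) PN.domain)
    (hKd : K.domain = {x | x 0 ∈ Ioo (0:ℝ) 1})
    (hKi : EqOn K.integrand (fun x => (√(1 - x 0 ^ 2))⁻¹ *
      (√(1 - (2 * s - 1) / (s ^ 3 * (2 - s)) * x 0 ^ 2))⁻¹) K.domain) :
    IsAlgebraic ℚ ((s ^ 2 - s + 1) / (3 * (1 - s) ^ 2)) ∧
      ∀ hl : IsAlgebraic ℚ ((s ^ 2 - s + 1) / (3 * (1 - s) ^ 2)),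
      toFormalPeriod (of PN) =
        toFormalPeriod (of (IntegralRep.unit.constMul _ hl)) * toFormalPeriod (of K) := by
  have hm := soloInformed_m3_mem hs
  have hma := soloInformed_m3_isAlgebraic hsa
  obtain ⟨-, -, f3, -⟩ := soloInformed_s3_facts hs
  obtain ⟨hσ, hsq, -, -, -, -⟩ := soloInformed_s3_sqrt hs
  have h0' : 0 < s := by linarith [hs.1]
  have h0 : s ≠ 0 := h0'.ne'
  have h1 : 1 - s ≠ 0 := (by linarith [hs.2] : (0:ℝ) < 1 - s).ne'
  have h2 : 2 - s ≠ 0 := (by linarith [hs.2] : (0:ℝ) < 2 - s).ne'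
  have hσ0 : √(s * (2 - s)) ≠ 0 := hσ.ne'
  have h3a : IsAlgebraic ℚ (3:ℝ) := by simpa using isAlgebraic_nat (R := ℚ) (A := ℝ) 3
  have hl : IsAlgebraic ℚ ((s ^ 2 - s + 1) / (3 * (1 - s) ^ 2)) := by
    rw [div_eq_mul_inv]
    exact (((hsa.pow 2).sub hsa).add isAlgebraic_one).mul
      (h3a.mul ((isAlgebraic_one.sub hsa).pow 2)).inv
  have hn : soloInformedM3 s * (√(s * (2 - s))) ^ 2 = (2 * s - 1) / s ^ 2 := by
    rw [hsq]; unfold soloInformedM3; field_simp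
  have hS2 : (soloInformedDivChainThree s hs hsa).s 2 = √(s * (2 - s)) := soloInformed_s3_two
  have hPNi' : EqOn PN.integrand (fun x => (1 - soloInformedM3 s *
      (soloInformedDivChainThree s hs hsa).s 2 ^ 2 * x 0 ^ 2)⁻¹ *
      ((√(1 - x 0 ^ 2))⁻¹ * (√(1 - (2 * s - 1) / (s ^ 3 * (2 - s)) * x 0 ^ 2))⁻¹)) PN.domain := by
    intro x hx
    rw [hPNi hx, hS2, hn]
  have hprod : (1 - s * (2 - s)) * ((1 - s) ^ 2 / s ^ 2) = ((1 - s) ^ 2 / s) ^ 2 := by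
    field_simp
    ring
  have hsqrt : √((1 - (√(s * (2 - s))) ^ 2) * (1 - soloInformedM3 s * (√(s * (2 - s))) ^ 2)) =
      (1 - s) ^ 2 / s := by
    rw [hsq, f3, hprod, Real.sqrt_sq (div_nonneg (sq_nonneg _) h0'.le)]
  refine ⟨hl, fun hl' => ?_⟩
  obtain ⟨hl0, h⟩ := soloInformed_divChain_thirdKind_pointClass (soloInformedDivChainThree s hs hsa)
    hm hma (p := 2) two_pos (by norm_num) PN K hPNd hPNi' hKd hKi
  rw [h hl0, soloInformed_pointRep_congr hl0 hl' ?_]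
  rw [hS2, soloInformed_divChainThree_zeta hs hsa, soloInformed_divChainThree_zeta₂ hs hsa, hsqrt]
  push_cast
  have e1 : ((3:ℝ) * ((1 - s) ^ 2 / s / √(s * (2 - s))))⁻¹ *
      (2 * (soloInformedM3 s * s * (s * √(s * (2 - s)) + √(s * (2 - s)))) -
        3 * (soloInformedM3 s * s * (s * √(s * (2 - s))))) =
      soloInformedM3 s * s ^ 2 * (√(s * (2 - s))) ^ 2 * (2 - s) / (3 * (1 - s) ^ 2) := by
    field_simp
    ring
  rw [e1, hsq]
  unfold soloInformedM3
  field_simp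
  ring

/-- The fibre `s = ⅔` at the second division point: **`3·Π(¾ | 27/32) = 7·K(27/32)`**, for all
representations. [this work] -/
theorem soloInformed_trisection_fibre₂ (PN K : IntegralRep 1)
    (hPNd : PN.domain = {x | x 0 ∈ Ioo (0:ℝ) 1})
    (hPNi : EqOn PN.integrand (fun x => (1 - 3 / 4 * x 0 ^ 2)⁻¹ *
      ((√(1 - x 0 ^ 2))⁻¹ * (√(1 - 27 / 32 * x 0 ^ 2))⁻¹)) PN.domain)
    (hKd : K.domain = {x | x 0 ∈ Ioo (0:ℝ) 1})
    (hKi : EqOn K.integrand (fun x => (√(1 - x 0 ^ 2))⁻¹ * (√(1 - 27 / 32 * x 0 ^ 2))⁻¹)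
      K.domain) :
    3 * PN.value = 7 * K.value := by
  have hs : (2/3 : ℝ) ∈ Ioo (1/2:ℝ) 1 := by norm_num
  have hsa : IsAlgebraic ℚ (2/3 : ℝ) := by
    simpa using isAlgebraic_algebraMap (R := ℚ) (A := ℝ) (2/3 : ℚ)
  have hn : (2 * (2/3:ℝ) - 1) / (2/3) ^ 2 = 3 / 4 := by norm_num
  have hm : (2 * (2/3:ℝ) - 1) / ((2/3) ^ 3 * (2 - 2/3)) = 27 / 32 := by norm_num
  obtain ⟨hl, h⟩ := soloInformed_trisection_thirdKind₂ (2/3) hs hsa PN K hPNd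
    (by rw [hn, hm]; exact hPNi) hKd (by rw [hm]; exact hKi)
  have e := congrArg evalP (h hl)
  simp only [map_mul, evalP_toFormalPeriod_of, IntegralRep.value_constMul,
    IntegralRep.value_unit, mul_one] at e
  rw [e]
  norm_num
  ring

end Summit.KontsevichZagierPeriods.KontsevichZagierPeriods.Theorems

end
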